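import Summits.CriticalPhenomena.PercolationContinuityZ3.Theorems.PercNearOneGluingNoHeavyLowerTailSahiCombMixCoord

/-!
# The comb (tensor-Bernstein) hierarchy for Sahi's `E_k`, XLV: the MEET STEP — AND-ing a coordinate into any sub-family preserves the hereditary
# comb class, FOR EVERY NUMBER OF EVENTS (no monotonicity needed)

Support file of the one-cut programme (crux `NoHeavyLowerTail`, stmt-CriticalPhenomena-4575; cell `prim-masterthm`, seat P3, gen 9;
`run/shared/lean/prim/prim-masterthm/prim-masterthm-p3/HIERARCHY.md` §17).  Vocabulary: `SahiComb.CombPos`, the hereditary comb class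
`SahiCombHereditary.CombHereditary` (`…SahiCombHereditary`), the comb-level law of total cumulance for separable families
`combPos_sahiE_ind_separable_local` (`…SahiCombTensorisation`), chains `combPos_sahiE_ind_of_chain` (`…SahiCombMeetAbsorbing`).

THE QUESTION (HIERARCHY §16 NEXT (i)).  Comb H-MIX(4) (`SahiCombMix.combHereditary_orCoord_four`, gen 8) says that OR-ing a fresh coordinate into any
sub-family of FOUR hereditarily comb-positive increasing events preserves hereditary comb positivity, and that statement is sharp in the number of events
(H-MIX(5) is false).  What about the dual MEET step `U_j ↦ U_j ∩ {e ∈ ω}`?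
* `andCoord U e G` — AND the coordinate event `{e ∈ ω}` into the members selected by `G`.
* **`combPos_sahiE_ind_inter_coordChain`** — the engine: for ANY events `V_0,…,V_k` ignoring `e` all of whose sub-family rows are comb-positive, and ANY slots
  `W_l ∈ {{e ∈ ω}, Ω}`, the family `(V_l ∩ W_l)_l` has `E_{k+1}(μ_p)` comb-positive at multidegree `k+1`.  Proof = the comb-level law of total cumulance
  (`combPos_sahiE_ind_separable_local` with `F = ι ∖ {e}`): every term is (a product of sub-family rows of `V`) × (a row of the CHAIN `{e ∈ ω} ⊆ Ω`, comb-positive by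
  `combPos_sahiE_ind_of_chain`); all signs plus.  This is the comb form of gen 6's law-level AND-mixture theorem (`SahiMixture.andMixture_bernsteinPos`).
* **`combHereditary_andCoord`** — COMB MEET STEP, EVERY `n`: `CombHereditary U →  CombHereditary (andCoord U e G)` for events ignoring `e` (rows of the
  ∩-closed family of the new family are `(⋂_K U) ∩ W` with `W ∈ {{e ∈ ω}, Ω}`).  No monotonicity, no bound on `n` — in contrast with the OR step.
* **`combAllOrders_andCoord`** — the same for plain all-orders comb positivity (`SahiCombDisjunct.CombAllOrders`, multisets of members): the AND companion of the
  (open) disjunctive closure `SahiCombDisjunct.CombDisjunctiveClosure`, a theorem for every `n`.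
* `combHereditary_of_chain` — chains of increasing events are `CombHereditary` (so the constant families `∅ / Ω` are admissible starting points).
* Law-level shadows under every product measure (`hereditaryAllOrders_andCoord`).
USE (companion file `…SahiCombMixCaterpillar`): alternating OR-steps (n ≤ 4, comb H-MIX(4)) and AND-steps (this file) from a constant family shows that every
family of ≤ 4 increasing events built as NESTED CANALYZING (read-once decision-list) functions along a common coordinate order is comb-positive at every order.
HONEST FRAMING: nothing here asserts (M⁺-k) or `C_k` for `k ≥ 3` in general. [this work]
-/

noncomputable section

open scoped Classical

namespace Summit.CriticalPhenomena.PercolationContinuityZ3.Theorems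

open Finset Function
open Literature.Combinatorics.Sahi2008
open Literature.Combinatorics.Sahi2008.PartitionForm
open Literature.Probability.Percolation (DeterminedBy determinedBy_iff determinedBy_univ)
open Literature.Probability.Percolation.DecisionTree (ind ind_of_mem ind_of_not_mem ind_nonneg)
open SahiComb
open SahiCombDisjunct (orCoord CombAllOrders)

variable {ι : Type} [Fintype ι]

namespace SahiCombHereditary

/-! ### The AND step and the coordinate chain `{e ∈ ω} ⊆ Ω` -/

/-- AND-ing the coordinate event `{e ∈ ω}` into the members selected by `G` (the MEET step; dual of `SahiCombDisjunct.orCoord`). [this work] -/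
def andCoord {n : ℕ} (U : Fin n → Set (Set ι)) (e : ι) (G : Fin n → Bool) : Fin n → Set (Set ι) :=
  fun j => bif G j then U j ∩ {ω : Set ι | e ∈ ω} else U j

omit [Fintype ι] in
/-- Membership in an AND-ed member. [this work] -/
theorem mem_andCoord {n : ℕ} (U : Fin n → Set (Set ι)) (e : ι) (G : Fin n → Bool) (j : Fin n) (ω : Set ι) :
    ω ∈ andCoord U e G j ↔ ω ∈ U j ∧ ω ∈ (bif G j then {ω : Set ι | e ∈ ω} else Set.univ) := by
  unfold andCoord; cases G j <;> simp

omit [Fintype ι] in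
/-- Members of `andCoord U e G` are increasing when the `U_j` are. [this work] -/
theorem isUpperSet_andCoord {n : ℕ} {U : Fin n → Set (Set ι)} (hU : ∀ j, IsUpperSet (U j)) (e : ι) (G : Fin n → Bool) (j : Fin n) :
    IsUpperSet (andCoord U e G j) := by
  unfold andCoord
  cases G j
  · exact hU j
  · exact (hU j).inter fun ω ω' hle (he : e ∈ ω) => hle he

omit [Fintype ι] in
/-- Rows of the ∩-closed family of the AND-ed family split as `(⋂_K U) ∩ (⋂_K W)`, `W_i ∈ {{e ∈ ω}, Ω}`. [this work] -/
theorem biInter_andCoord {n : ℕ} (U : Fin n → Set (Set ι)) (e : ι) (G : Fin n → Bool) (K : Finset (Fin n)) :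
    (⋂ i ∈ K, andCoord U e G i) = (⋂ i ∈ K, U i) ∩ ⋂ i ∈ K, (bif G i then {ω : Set ι | e ∈ ω} else Set.univ) := by
  ext ω
  simp only [Set.mem_iInter, Set.mem_inter_iff, mem_andCoord]
  exact ⟨fun h => ⟨fun i hi => (h i hi).1, fun i hi => (h i hi).2⟩, fun h i hi => ⟨h.1 i hi, h.2 i hi⟩⟩

omit [Fintype ι] in
/-- An intersection of sets each equal to `X` or to `univ` is `X` or `univ`. [folklore] -/
theorem iInter_eq_or_eq_univ {κ : Sort*} {X : Set (Set ι)} {T : κ → Set (Set ι)} (h : ∀ k, T k = X ∨ T k = Set.univ) :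
    (⋂ k, T k) = X ∨ (⋂ k, T k) = Set.univ := by
  by_cases hk : ∃ k, T k = X
  · obtain ⟨k, hk⟩ := hk
    left
    refine Set.Subset.antisymm (fun ω hω => hk ▸ Set.mem_iInter.1 hω k) fun ω hω => Set.mem_iInter.2 fun k' => ?_
    rcases h k' with h' | h'
    · rw [h']; exact hω
    · rw [h']; exact Set.mem_univ ω
  · right
    refine Set.eq_univ_of_forall fun ω => Set.mem_iInter.2 fun k' => ?_
    rcases h k' with h' | h'
    · exact absurd ⟨k', h'⟩ hk
    · rw [h']; exact Set.mem_univ ω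

omit [Fintype ι] in
/-- The selected coordinate events `⋂_{i∈K} W_i` (`W_i = {e ∈ ω}` if `G i`, else `Ω`) are `{e ∈ ω}` or `Ω`. [this work] -/
theorem biInter_coordSel_eq_or {n : ℕ} (e : ι) (G : Fin n → Bool) (K : Finset (Fin n)) :
    (⋂ i ∈ K, (bif G i then {ω : Set ι | e ∈ ω} else Set.univ)) = {ω : Set ι | e ∈ ω}
      ∨ (⋂ i ∈ K, (bif G i then {ω : Set ι | e ∈ ω} else Set.univ)) = Set.univ :=
  iInter_eq_or_eq_univ fun i => iInter_eq_or_eq_univ fun _ => by cases G i <;> simp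

/-! ### Determination bookkeeping -/

omit [Fintype ι] in
/-- An event ignoring `e` (both `e`-sections equal to it) is determined by the other coordinates. [folklore] -/
theorem determinedBy_erase_of_secAt {A : Set (Set ι)} {e : ι} (hA : ∀ b : Bool, secAt e b A = A) [DecidableEq ι] [Fintype ι] :
    DeterminedBy A (↑((univ : Finset ι).erase e) : Set ι) := by
  have h := SahiCombJunta.determinedBy_secAt_compl e true A
  rw [hA] at h
  refine h.mono fun x hx => ?_
  simp only [Finset.coe_erase, Finset.coe_univ, Set.mem_sdiff, Set.mem_univ, true_and, Set.mem_singleton_iff]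
  exact hx

omit [Fintype ι] in
/-- `{e ∈ ω}` and `Ω` are determined by `{e}` — here phrased for the complement of `ι ∖ {e}`. [folklore] -/
theorem determinedBy_coordOrUniv {W : Set (Set ι)} {e : ι} (hW : W = {ω : Set ι | e ∈ ω} ∨ W = Set.univ) [DecidableEq ι] [Fintype ι] :
    DeterminedBy W (↑((univ : Finset ι).erase e) : Set ι)ᶜ := by
  rcases hW with rfl | rfl
  · rw [determinedBy_iff]
    intro ω ω' h
    have he : e ∈ (↑((univ : Finset ι).erase e) : Set ι)ᶜ := by simp
    have := Set.ext_iff.1 h e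
    simp only [Set.mem_inter_iff, he, and_true] at this
    exact this
  · exact determinedBy_univ _

/-! ### The engine: a family ignoring `e`, intersected slotwise with the chain `{e ∈ ω} ⊆ Ω` -/

/-- **Comb positivity of `(V_l ∩ W_l)_l` with `W_l ∈ {{e ∈ ω}, Ω}`** from comb positivity of the sub-family rows of `V` (events ignoring `e`, not necessarily
monotone): the comb-level law of total cumulance across the bipartition `ι = (ι ∖ {e}) ⊔ {e}`, whose coin-side factors are rows of the chain `{e ∈ ω} ⊆ Ω`.
[this work] -/
theorem combPos_sahiE_ind_inter_coordChain {k : ℕ} (e : ι) (V W : Fin (k + 1) → Set (Set ι))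
    (hVe : ∀ (l : Fin (k + 1)) (b : Bool), secAt e b (V l) = V l)
    (hW : ∀ l, W l = {ω : Set ι | e ∈ ω} ∨ W l = Set.univ)
    (HV : ∀ B : Finset (Fin (k + 1)), CombPos (fun _ : ι => B.card)
      (fun p => sahiE (bernoulliWeight p) B.card (fun j => ind (V (B.orderEmbOfFin rfl j))))) :
    CombPos (fun _ : ι => k + 1) (fun p => sahiE (bernoulliWeight p) (k + 1) (fun l => ind (V l ∩ W l))) := by
  refine SahiCombTensor.combPos_sahiE_ind_separable_local ((univ : Finset ι).erase e) V W (fun l => determinedBy_erase_of_secAt (hVe l))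
    (fun l => determinedBy_coordOrUniv (hW l)) HV fun c => ?_
  -- the coin side: every slot `⋂_{j ∈ block} W_j` is `{e ∈ ω}` or `Ω`, a chain of increasing events
  have hslot : ∀ m : Fin c.length,
      (⋂ j : Fin (block c m).card, W ((block c m).orderEmbOfFin rfl j)) = {ω : Set ι | e ∈ ω}
        ∨ (⋂ j : Fin (block c m).card, W ((block c m).orderEmbOfFin rfl j)) = Set.univ := fun m =>
    iInter_eq_or_eq_univ fun j => hW _
  refine combPos_sahiE_ind_of_chain _ (fun m => ?_) fun i j => ?_
  · rcases hslot m with h | h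
    · rw [h]; exact fun ω ω' hle (he : e ∈ ω) => hle he
    · rw [h]; exact isUpperSet_univ
  · rcases hslot i with hi | hi <;> rcases hslot j with hj | hj
    · left; rw [hi, hj]
    · left; rw [hj]; exact Set.subset_univ _
    · right; rw [hi]; exact Set.subset_univ _
    · left; rw [hi, hj]

/-! ### The meet step preserves the hereditary comb class, every `n` -/

/-- **COMB MEET STEP (every `n`).**  If the events `U_0,…,U_{n−1}` of a finite cube ignore the coordinate `e` and their ∩-closed family is comb-positive at every
order, then so is the ∩-closed family of `(U_j ∩ [G j]·{e ∈ ω})_j`, for every selector `G`.  No monotonicity and no bound on `n` (contrast: the OR step is true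
for `n ≤ 4` only). [this work] -/
theorem combHereditary_andCoord {n : ℕ} (U : Fin n → Set (Set ι)) (e : ι) (G : Fin n → Bool)
    (hUe : ∀ (j : Fin n) (b : Bool), secAt e b (U j) = U j) (hU : CombHereditary U) : CombHereditary (andCoord U e G) := by
  intro m K
  rcases m with _ | k
  · exact (CombPos.zero _).congr fun p => sahiE_zero _ _
  · have hrow : (fun j => ind (⋂ i ∈ K j, andCoord U e G i))
        = fun j => ind ((⋂ i ∈ K j, U i) ∩ ⋂ i ∈ K j, (bif G i then {ω : Set ι | e ∈ ω} else Set.univ)) := by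
      funext j; rw [biInter_andCoord]
    rw [show (fun p => sahiE (bernoulliWeight p) (k + 1) (fun j => ind (⋂ i ∈ K j, andCoord U e G i)))
        = fun p => sahiE (bernoulliWeight p) (k + 1)
            (fun j => ind ((⋂ i ∈ K j, U i) ∩ ⋂ i ∈ K j, (bif G i then {ω : Set ι | e ∈ ω} else Set.univ))) from by rw [hrow]]
    refine combPos_sahiE_ind_inter_coordChain e (fun j => ⋂ i ∈ K j, U i)
      (fun j => ⋂ i ∈ K j, (bif G i then {ω : Set ι | e ∈ ω} else Set.univ))
      (fun j b => SahiCombMix.secAt_biInter U e hUe (K j) b) (fun j => biInter_coordSel_eq_or e G (K j)) fun B => ?_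
    exact hU B.card (fun j => K (B.orderEmbOfFin rfl j))

/-- **The AND companion of the disjunctive closure, every `n`**: if every multiset of the events `U_j` (ignoring `e`) is comb-positive, so is every multiset of
`(U_j ∩ [G j]·{e ∈ ω})_j`. [this work] -/
theorem combAllOrders_andCoord {n : ℕ} (U : Fin n → Set (Set ι)) (e : ι) (G : Fin n → Bool)
    (hUe : ∀ (j : Fin n) (b : Bool), secAt e b (U j) = U j) (hU : CombAllOrders U) : CombAllOrders (andCoord U e G) := by
  intro m s
  rcases m with _ | k
  · exact (CombPos.zero _).congr fun p => sahiE_zero _ _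
  · have hrow : (fun j => ind (andCoord U e G (s j)))
        = fun j => ind (U (s j) ∩ (bif G (s j) then {ω : Set ι | e ∈ ω} else Set.univ)) := by
      funext j; unfold andCoord; cases G (s j) <;> simp
    rw [show (fun p => sahiE (bernoulliWeight p) (k + 1) (fun j => ind (andCoord U e G (s j))))
        = fun p => sahiE (bernoulliWeight p) (k + 1) (fun j => ind (U (s j) ∩ (bif G (s j) then {ω : Set ι | e ∈ ω} else Set.univ))) from by
          rw [hrow]]
    refine combPos_sahiE_ind_inter_coordChain e (fun j => U (s j)) (fun j => bif G (s j) then {ω : Set ι | e ∈ ω} else Set.univ)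
      (fun j b => hUe (s j) b) (fun j => by cases G (s j) <;> simp) fun B => ?_
    exact hU B.card (fun j => s (B.orderEmbOfFin rfl j))

/-- Law-level shadow: under every product measure the AND-ed family of a `CombHereditary` family ignoring `e` is hereditarily all-orders positive. [this work] -/
theorem hereditaryAllOrders_andCoord {n : ℕ} (U : Fin n → Set (Set ι)) (e : ι) (G : Fin n → Bool)
    (hUe : ∀ (j : Fin n) (b : Bool), secAt e b (U j) = U j) (hU : CombHereditary U) (p : ι → unitInterval) :
    SahiMixture.HereditaryAllOrders (bernoulliWeight p) (andCoord U e G) :=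
  (combHereditary_andCoord U e G hUe hU).hereditaryAllOrders p

/-! ### Chains are hereditarily comb-positive -/

omit [Fintype ι] in
/-- A finite intersection of members of a chain of sets containing `univ`-or-members is a member or `univ`. [folklore] -/
theorem biInter_chain_eq {n : ℕ} {U : Fin n → Set (Set ι)} (h : ∀ i j : Fin n, U i ⊆ U j ∨ U j ⊆ U i) (K : Finset (Fin n)) :
    (⋂ i ∈ K, U i) = Set.univ ∨ ∃ i ∈ K, (⋂ i ∈ K, U i) = U i := by
  induction K using Finset.induction_on with
  | empty => left; simp
  | insert a K haK ih =>
    rw [Finset.set_biInter_insert]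
    rcases ih with hK | ⟨i, hi, hK⟩
    · right; exact ⟨a, Finset.mem_insert_self a K, by rw [hK, Set.inter_univ]⟩
    · rw [hK]
      rcases h a i with hai | hia
      · right; exact ⟨a, Finset.mem_insert_self a K, Set.inter_eq_left.2 hai⟩
      · right; exact ⟨i, Finset.mem_insert_of_mem hi, Set.inter_eq_right.2 hia⟩

/-- **Chains of increasing events are `CombHereditary`** (every row of the ∩-closed family is again a chain, `combPos_sahiE_ind_of_chain`).  In particular the
constant families (each member `∅` or `Ω`) are. [this work] -/
theorem combHereditary_of_chain {n : ℕ} (U : Fin n → Set (Set ι)) (hU : ∀ j, IsUpperSet (U j))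
    (h : ∀ i j : Fin n, U i ⊆ U j ∨ U j ⊆ U i) : CombHereditary U := by
  intro m K
  refine combPos_sahiE_ind_of_chain (fun j => ⋂ i ∈ K j, U i) (fun j => isUpperSet_biInter hU (K j)) fun a b => ?_
  rcases biInter_chain_eq h (K a) with ha | ⟨i, _, ha⟩ <;> rcases biInter_chain_eq h (K b) with hb | ⟨j, _, hb⟩
  · left; rw [ha, hb]
  · right; rw [ha]; exact Set.subset_univ _
  · left; rw [hb]; exact Set.subset_univ _
  · simp only [ha, hb]; exact h i j

/-- The constant families (each member `∅` or `Ω`) are `CombHereditary`. [this work] -/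
theorem combHereditary_constFamily {n : ℕ} (c : Fin n → Bool) :
    CombHereditary (fun j => bif c j then (Set.univ : Set (Set ι)) else ∅) := by
  refine combHereditary_of_chain _ (fun j => ?_) fun i j => ?_
  · cases c j
    · exact isUpperSet_empty
    · exact isUpperSet_univ
  · cases c i <;> cases c j <;> simp

end SahiCombHereditary

end Summit.CriticalPhenomena.PercolationContinuityZ3.Theorems

end
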